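import Literature.MathematicalPhysics.QuantumFieldTheory.Balaban1983to89.B8Prop5JoinSectELocalRDRec
import Literature.MathematicalPhysics.QuantumFieldTheory.Balaban1983to89.B8Prop5JoinSectELocalRDTraceFree

/-!
# `Balaban1983to89.B8Prop5JoinSectELocalRDTraceFreeRec` — RECORD TWIN of `B8Prop5JoinSectELocalRDTraceFree` ([Balaban1985RegularSpaces] Prop. 5 (1.107)–(1.109) p. 94,
# Sect. D–E pp. 91–96: PROPOSITION 5's FIXED POINT IN THE KNIT's CURRENCY — JOIN-B, local inversion route, [4]'s inverse laws on print's domains — WITH THE TRACE-FREE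
# CLAUSE «`τ(λ′(x)) = 0` at every site» for every continuous tracial functional `τ`, given a `τ`-free datum, correction `H_c` and `τ`-compatible letters) FOR THE
# SYMMETRISED CENTRED block averaging (0.4) of [Balaban1987RG1]

statement-level skeleton of published theorems with citation tags; proofs where landed; nothing here is a claim about the Yang–Mills mass gap

T. Bałaban, *Spaces of regular gauge field configurations on a lattice and gauge fixing conditions*, Commun. Math. Phys. **99** (1985) 75–102 `[Balaban1985RegularSpaces]`
("[6]"): Proposition 5 (1.107)–(1.109) p. 94, (1.95)–(1.106) pp. 92–94, (1.113)–(1.114) p. 95, (1.78)–(1.79) p. 90, (1.29) p. 81; `𝔤`-valued gauge parameters p. 76 and (1.17)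
p. 78; T. Bałaban, *Averaging operations for lattice gauge theories*, Commun. Math. Phys. **98** (1985) 17–51 `[Balaban1985Averaging]` ("[3]"): p. 20 («We consider a Lie
subgroup G of a unitary group U(N)»); T. Bałaban, *Renormalization group approach to lattice gauge field theories. I*, Commun. Math. Phys. **109** (1987) 249–301
`[Balaban1987RG1]` ("[I]"): (0.3)–(0.4) pp. 252–253.  STATUS: published, refereed.

CITATION HEADER (lean-in-tree rule).  Cell `pub-ymgap`, «N05-REC» R8 = the `G`∕τ-EDITION OF RECORD (desk `R6-PLAN.md` §6 (B)), file T1 — LEAD PEN dag-n05-e g40.  WHAT IS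
REPRODUCED = ✓ the engine module `B8Prop5JoinSectELocalRDTraceFree` (cell `lit-balaban`, seat `lit-balaban-t2s-1`) VERBATIM under the N05-REC token map of
`B8Prop5JoinSectELocalRDRec` (`InAx ∕ Restr129 ∕ Cond179 ∕ QT ↦ InAxZ ∕ Restr129Z ∕ Cond179Z ∕ QTZ`, tower `B8Ineq130.tlo ∕ thi ↦ B8Ineq130Rec.tlo ∕ thi` (CENTRED), regime
`(hL : 2 ≤ L) ↦ (hLs : L = 2sL+1) (hs1 : 1 ≤ sL)`, `C0 ↦ C0Z`, the gauge-fixing witness constant `40d·c_B ↦ 20dKZ·c_B` with the record smallness): ★ `hFP_kLevel_of179_local_RD_traceFree`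
= ✓`B8Prop5JoinSectELocalRDRec.hFP_kLevel_of179_local_RD` re-run through the STRUCTURE-FREE engine theorem `B8Prop5GaugeParamTraceFree.gaugeParam_kLevel_traceFree` (BY NAME) with
the extra conjunct `∀ x, τ(λ′(x)) = 0` under the displayed hypotheses (T1) `τ(xy) = τ(yx)`, (T2) `τ(log(eᵃeᵇ)) = τa + τb` (`‖a‖ + ‖b‖ ≤ ½`), `τ(D*A) = 0` on the `Ω_j`, `H_c`
`τ`-compatible on the ball, `R`, `G′` `τ`-compatible; (1.29) by the record's `B8Prop5JoinSectERec.restr129_mul_gaugeExp_local`, the multiplier clause by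
`B8Prop5KLevelLettersRec.multiplier_iff_of_whyZ`.  (`apply_covDivB` of the engine file is structure-free and consumed BY NAME.)  THEOREM NAMES = the engine's (namespace `…TraceFreeRec`).  Kind «kernel-checked proof», theorems only: no
`def`, no `… : Prop` fact, no `instance`, no `notation`, no existing module modified.  `--supports stmt-QuantumFields-20541` (K0⁷-keyed, COUNT-NEUTRAL).

HONEST SCOPE.  A re-run with one clause threaded; nothing of Proposition 5 ∕ Sect. E beyond the inputs is claimed; `H_c` is still a letter here (instantiated by the record Sect. E
with ITS `τ`-clause in `B8SectETraceFreeRec`); the record crown stays CONDITIONAL ×2 on the named Cov facts; `HThm4Rec` UNDISCHARGED; N05 ∕ N07 NOT discharged; one finite `𝕋⁴`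
programme at fixed `ε`, Bałaban AS PRINTED; nothing continuum ∕ ℝ⁴ ∕ OS ∕ mass-gap ∕ Clay.  No `sorry`, no `def`.
-/

noncomputable section

open NormedSpace Metric Set Filter Topology
open Complex (I)
open scoped BigOperators

namespace Literature.MathematicalPhysics.QuantumFieldTheory.Balaban1983to89.B8Prop5JoinSectELocalRDTraceFreeRec


open MatrixLog (mlog)
open B7Prop1Explicit (e U1 expUnit)
open B7Prop2Explicit (unitaryUnits c2')
open B7Prop2Rec (C0Z)
open B7Prop4GeneralLevelsRec (cZ KZ gZ_nonneg)
open B7Prop1Local (InBox pdevOn)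
open B7Prop3Flat (expCfg c3)
open B7Eq78Linearization (conjR)
open B7Prop10General (C6 C4G)
open B7Prop9Flat (C5')
open B8Ineq130Rec (tlo thi)
open B7Eq92Concrete (mgauge)
open B8Eq119TwistedAxialRec (InAxZ Restr129Z)
open B8Eq178AveragesRec (Cond179Z)
open B8Ineq132 (covDerivFwd covDeriv)
open B8Eq138LandauZd (covLap covDivB)
open B8Eq138LandauZdRec (QTZ)
open B8Eq182Proof (gAd)
open B8Eq184Proof (gaugeExp)
open B8Eq188Proof (frakF3 gAd_neg)
open B8LambdaSpaceKLevel (wt lamSubK lamOf norm_le_iff)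
open B8Prop5ContractionKLevel (Bd2 Mc Kc Zsol Vop Wsrc PsiP5)
open B8Prop5GaugeParamKLevel (gpar_size)
open B8Prop5GaugeParamTraceFree (gaugeParam_kLevel_traceFree apply_covDeriv)
open B8Prop5JoinSectELocalRDTraceFree (apply_covDivB)
open B8Prop5KLevelLettersRec (multiplier_iff_of_whyZ)
open B8Eq195Linear (proj325_sub)
open B8Eq195LinearRange (q_g_proj325_range)
open B8Prop5JoinSectERec (restr129_mul_gaugeExp_local)
open B8Prop5JoinHFP (covLap_neg')

-- `Site` alone could resolve to the torus sites of `Setup.lean`; re-export the `ℤ^d` sites of `B7Prop1Explicit`.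
export B7Prop1Explicit (Site)

variable {d : ℕ} {𝔸 : Type*} [CStarAlgebra 𝔸] [Nontrivial 𝔸]

variable (τ : 𝔸 →L[ℂ] ℂ)

variable {L sL k : ℕ} {η : ℝ} {Ω Λs : ℕ → Set (Site d)} {Eb : ℕ → Set (Site d × Fin d)} {U₀ : Site d → Fin d → 𝔸ˣ}
  {A : Site d → Fin d → 𝔸} {u₁ : Site d → 𝔸ˣ}

/-- ★ **PROPOSITION 5's GAUGE PARAMETER (JOIN-B, local route, laws on print's domains) WITH THE TRACE-FREE CLAUSE.**
`B8Prop5JoinSectELocalRD.hFP_kLevel_of179_local_RD` VERBATIM (letters `G′, Δ, Q′, Q′ᵀ, 𝔄, C` with `g_rightΩ`, `c_range`, readings; the tower-local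
inversion regime; the correction `H_c` with its eight binders; the datum; windows ∕ smallness; Sect. E's (1.114) in printed use `h179E`), PLUS a
continuous functional `τ` with (T1)–(T2), `τ(D*A) = 0` on the `Ω_j`, `H_c` `τ`-compatible on the ball, `R`, `G′` `τ`-compatible.  CONCLUSION: the
gauge parameter `λ′` — Hermitian, `= 0` off `Ω₀`, **`τ(λ′(x)) = 0` at every site**, (1.108) on the `Eb j`, the multiplier form of the Landau
equation on `Ω₀`, and (1.29) at `k` levels for `u₁·e^{iλ′}`. [cite: Balaban1985RegularSpaces, Prop. 5 (1.107)–(1.109) p.94, (1.95)–(1.106) pp.92–94, (1.113)–(1.114) p.95, (1.29) p.81, (1.17) p.78] -/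
theorem hFP_kLevel_of179_local_RD_traceFree (hτ : ∀ x y : 𝔸, τ (x * y) = τ (y * x))
    (hlog : ∀ a b : 𝔸, ‖a‖ + ‖b‖ ≤ 1 / 2 → τ (mlog (exp a * exp b)) = τ a + τ b)
    (hLs : L = 2 * sL + 1) (hs1 : 1 ≤ sL) (hη : 0 < η) (hd : 1 ≤ d) (hU₀ : ∀ x κ, U₀ x κ ∈ unitaryUnits 𝔸)
    (hEbΩ : ∀ j, j ≤ k → ∀ x ∈ Ω j, ∀ μ : Fin d, (x, μ) ∈ Eb j ∧ (x - e μ, μ) ∈ Eb j)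
    (hEbT : ∀ j, j ≤ k → ∀ y ∈ Λs j, ∀ (x : Site d) (κ : Fin d), InBox (tlo L y j) (thi L y j) x →
      InBox (tlo L y j) (thi L y j) (x + e κ) → (x, κ) ∈ Eb j)
    -- letters of [4]
    (g Δ : (Site d → 𝔸) →ₗ[ℂ] (Site d → 𝔸)) (q : (Site d → 𝔸) →ₗ[ℂ] (ℕ → Site d → 𝔸)) (qs : (ℕ → Site d → 𝔸) →ₗ[ℂ] (Site d → 𝔸))
    (Aw c : (ℕ → Site d → 𝔸) →ₗ[ℂ] (ℕ → Site d → 𝔸))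
    (g_rightΩ : ∀ x, ∀ y ∈ Ω 0, (Δ (g x) + qs (Aw (q (g x)))) y = x y)
    (c_range : ∀ f, q (g (g (qs (c (q f))))) = q f)
    (hΔ : ∀ (f : Site d → 𝔸), ∀ x ∈ Ω 0, Δ f x = covLap η U₀ ((Ω 0).indicator f) x)
    (hqs : ∀ (μ : ℕ → Site d → 𝔸), ∀ x ∈ Ω 0, qs μ x = QTZ L k Λs U₀ μ x)
    (Hc : (Site d → 𝔸) → (Site d → 𝔸))
    -- the tower-local regime of the inversion route (datum AT u₁)
    {B : Site d → Fin d → 𝔸} {α₀ αP cB : ℝ}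
    (hα : 0 < α₀) (hα3 : C0Z d * α₀ ≤ 1 / 3) (hα4 : 4 * α₀ ≤ c2' d L) (hcB : 0 ≤ cB)
    (hαP : 0 < αP) (hαP3 : C0Z d * αP ≤ 1 / 3) (hαP2 : 2 * αP ≤ c2' d L)
    (hBu : ∀ (x : Site d) (κ : Fin d), expCfg B x κ ∈ unitaryUnits 𝔸)
    (h33 : ∀ j, j ≤ k → ∀ y ∈ Λs j, pdevOn (tlo L y j) (thi L y j) U₀ < α₀ * (((L : ℝ) ^ j)⁻¹) ^ 2)
    (h69 : ∀ j, j ≤ k → ∀ y ∈ Λs j, ∀ (x : Site d) (κ : Fin d), InBox (tlo L y j) (thi L y j) x →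
      InBox (tlo L y j) (thi L y j) (x + e κ) → ‖B x κ‖ ≤ cB * ((L : ℝ) ^ j)⁻¹)
    (hP : ∀ j, j ≤ k → ∀ y ∈ Λs j, pdevOn (tlo L y j) (thi L y j) (expCfg B * U₀) < αP * (((L : ℝ) ^ j)⁻¹) ^ 2)
    (hAx : InAxZ L k Λs U₀ (mgauge U₀ u₁ (expCfg B) * U₀)) (h129 : Restr129Z L k Λs U₀ u₁)
    (hsmall : Real.exp (4 * cZ d * α₀) * (1 + 2 * (131072 * ((d : ℝ) + 1) ^ 2) * (KZ d L) ^ 2 * cB) ≤ 2)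
    (hc₃ : KZ d L * cB ≤ c3 d L) (hsc : 1024 * (d : ℝ) * KZ d L * cB ≤ 1) (hα₃' : 20 * d * KZ d L * cB ≤ 1 / 200)
    {α₄ BG BR h₀ h₁ h₂ l₀ l₁ l₂ cA cDA : ℝ}
    (hw₁ : 10 * C6 d * (4 * (2 * α₄)) ≤ 1) (hw₂ : 3000 * ((d : ℝ) + 1) * L * (4 * (2 * α₄)) ≤ 1)
    (hw₃ : C4G d L * (α₀ + 20 * d * KZ d L * cB + 4 * (2 * α₄)) ≤ 1)
    (hw₄ : 1024 * ((d : ℝ) + 1) * ((d : ℝ) + 4) * L ^ 2 * α₀ ≤ 1) (hw₅ : 32 * ((d : ℝ) + 1) ^ 2 * C6 d * L ^ 2 * α₀ ≤ 1)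
    (hw₆ : 16 * d * C5' d * C6 d * (L : ℝ) ^ 2 * α₀ ≤ 1) (hprod : 2 * C6 d * (20 * d * KZ d L * cB + 4 * (2 * α₄)) < 1 / 2)
    -- JOIN-B's windows, letters G′/R, H_c's eight binders, the datum
    (hα₄ : 0 < α₄) (hBG : 0 ≤ BG) (hBR : 0 ≤ BR) (hh₀ : 0 ≤ h₀) (hh₂ : 0 ≤ h₂) (hl₀ : 0 ≤ l₀) (hl₁ : 0 ≤ l₁)
    (hl₂ : 0 ≤ l₂) (hcA : 0 ≤ cA) (hcA' : cA ≤ 1 / 13) (hcDA : 0 ≤ cDA)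
    (ha₁' : α₄ / 4 + h₀ ≤ 1 / 24) (hb₁' : α₄ / 4 + h₁ ≤ 1 / 140) (hb₁ : 0 < α₄ / 4 + h₁) (hθ : 10 * (α₄ / 4 + h₀) * BR ≤ 1 / 2)
    (hh₀' : h₀ ≤ 3 * α₄ / 4) (hh₁' : h₁ ≤ 3 * α₄ / 4)
    (hG : ∀ (f : Site d → 𝔸) (m : ℝ), 0 ≤ m → Bd2 L η k Ω f m →
      (∀ x, ‖g f x‖ ≤ BG * m) ∧ ∀ j, j ≤ k → ∀ p ∈ Eb j, wt L η j * ‖covDerivFwd η U₀ p.2 (g f) p.1‖ ≤ BG * m)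
    (hGsupp : ∀ (f : Site d → 𝔸) (x : Site d), x ∉ Ω 0 → g f x = 0)
    (hGreal : ∀ f : Site d → 𝔸, (∀ j, j ≤ k → ∀ x ∈ Ω j, IsSelfAdjoint (f x)) → ∀ x, IsSelfAdjoint (g f x))
    (hRbd : ∀ (f : Site d → 𝔸) (m : ℝ), 0 ≤ m → Bd2 L η k Ω f m → Bd2 L η k Ω (f - g (qs (c (q (g f))))) (BR * m))
    (hRreal : ∀ f : Site d → 𝔸, (∀ j, j ≤ k → ∀ x ∈ Ω j, IsSelfAdjoint (f x)) →
      ∀ j, j ≤ k → ∀ x ∈ Ω j, IsSelfAdjoint ((f - g (qs (c (q (g f))))) x))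
    (hc0 : ∀ s : lamSubK η U₀ L k Eb, ‖s‖ ≤ α₄ / 4 → ∀ x, ‖Hc (lamOf s) x‖ ≤ h₀)
    (hc1 : ∀ s : lamSubK η U₀ L k Eb, ‖s‖ ≤ α₄ / 4 → ∀ j, j ≤ k → ∀ p ∈ Eb j, wt L η j * ‖covDerivFwd η U₀ p.2 (Hc (lamOf s)) p.1‖ ≤ h₁)
    (hc2 : ∀ s : lamSubK η U₀ L k Eb, ‖s‖ ≤ α₄ / 4 → Bd2 L η k Ω (covLap η U₀ (Hc (lamOf s))) h₂)
    (hcL0 : ∀ s t : lamSubK η U₀ L k Eb, ‖s‖ ≤ α₄ / 4 → ‖t‖ ≤ α₄ / 4 → ∀ x, ‖Hc (lamOf s) x - Hc (lamOf t) x‖ ≤ l₀ * ‖s - t‖)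
    (hcL1 : ∀ s t : lamSubK η U₀ L k Eb, ‖s‖ ≤ α₄ / 4 → ‖t‖ ≤ α₄ / 4 → ∀ j, j ≤ k → ∀ p ∈ Eb j,
      wt L η j * ‖covDerivFwd η U₀ p.2 (Hc (lamOf s) - Hc (lamOf t)) p.1‖ ≤ l₁ * ‖s - t‖)
    (hcL2 : ∀ s t : lamSubK η U₀ L k Eb, ‖s‖ ≤ α₄ / 4 → ‖t‖ ≤ α₄ / 4 →
      Bd2 L η k Ω (covLap η U₀ (Hc (lamOf s)) - covLap η U₀ (Hc (lamOf t))) (l₂ * ‖s - t‖))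
    (hcsa : ∀ s : lamSubK η U₀ L k Eb, ‖s‖ ≤ α₄ / 4 → (∀ x, IsSelfAdjoint (lamOf s x)) → ∀ x, IsSelfAdjoint (Hc (lamOf s) x))
    (hcsupp : ∀ s : lamSubK η U₀ L k Eb, ‖s‖ ≤ α₄ / 4 → ∀ x, x ∉ Ω 0 → Hc (lamOf s) x = 0)
    (hDA : Bd2 L η k Ω (fun y => covDivB η U₀ A y) cDA) (hDAsa : ∀ j, j ≤ k → ∀ x ∈ Ω j, IsSelfAdjoint (covDivB η U₀ A x))
    (hA : ∀ j, j ≤ k → ∀ x ∈ Ω j, ∀ μ : Fin d,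
      wt L η j * ‖A x μ‖ ≤ cA ∧ wt L η j * ‖conjR (U₀ (x - e μ) μ)⁻¹ (A (x - e μ) μ)‖ ≤ cA)
    (hAsa : ∀ x μ, IsSelfAdjoint (A x μ))
    (h103 : BG * Mc d BR (α₄ / 4 + h₁) cA h₂ cDA ≤ α₄ / 4)
    (h106 : BG * Kc d BR (α₄ / 4 + h₁) cA h₂ cDA l₂ (1 + l₀) (1 + l₁) ≤ 1 / 2)
    -- Sect. E's (1.114) in its printed use, for the inverse pair, at the abstract H_c
    (h179E : ∀ s : lamSubK η U₀ L k Eb, ‖s‖ ≤ α₄ / 4 → q (lamOf s) = 0 →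
      Cond179Z L k Λs U₀ (fun x => expUnit (((-I) • (lamOf s + Hc (lamOf s))) x)) u₁⁻¹)
    -- `τ`-freeness of the datum, the correction and the letters (joint J-SU)
    (hDAτ : ∀ j, j ≤ k → ∀ x ∈ Ω j, τ (covDivB η U₀ A x) = 0)
    (hcτ : ∀ s : lamSubK η U₀ L k Eb, ‖s‖ ≤ α₄ / 4 → (∀ x, τ (lamOf s x) = 0) → ∀ x, τ (Hc (lamOf s) x) = 0)
    (hRτ : ∀ f : Site d → 𝔸, (∀ j, j ≤ k → ∀ x ∈ Ω j, τ (f x) = 0) →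
      ∀ j, j ≤ k → ∀ x ∈ Ω j, τ ((f - g (qs (c (q (g f))))) x) = 0)
    (hGτ : ∀ f : Site d → 𝔸, (∀ j, j ≤ k → ∀ x ∈ Ω j, τ (f x) = 0) → ∀ x, τ (g f x) = 0) :
    ∃ lam : Site d → 𝔸, (∀ x, IsSelfAdjoint (lam x)) ∧ (∀ x, x ∉ Ω 0 → lam x = 0) ∧ (∀ x, τ (lam x) = 0) ∧
      (∀ j, j ≤ k → ∀ p ∈ Eb j, ‖lam p.1‖ ≤ α₄ ∧ wt L η j * ‖covDerivFwd η U₀ p.2 lam p.1‖ ≤ α₄) ∧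
      (∃ μ : ℕ → Site d → 𝔸, ∀ x ∈ Ω 0,
        covLap η U₀ ((Ω 0).indicator fun y => covDivB η U₀ A y + covLap η U₀ lam y +
          ((conjR (gaugeExp lam y)⁻¹ (covDivB η U₀ A y) - covDivB η U₀ A y) +
            (gAd (covLap η U₀ lam y) (lam y) - covLap η U₀ lam y) + ∑ μ, frakF3 η U₀ lam A y μ)) x = QTZ L k Λs U₀ μ x) ∧
      Restr129Z L k Λs U₀ (u₁ * gaugeExp lam) := by
  have hL1 : 1 ≤ L := by omega
  -- the letter R of (1.95)
  set R : (Site d → 𝔸) → (Site d → 𝔸) := fun f => f - g (qs (c (q (g f)))) with hRdef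
  have hR : ∀ f, R f = f - g (qs (c (q (g f)))) := fun f => rfl
  have hRsub : ∀ f f' : Site d → 𝔸, R (f - f') = R f - R f' := proj325_sub (R := R) hR
  have hR0 : R 0 = 0 := by rw [hR]; simp
  have hRneg : ∀ f : Site d → 𝔸, R (-f) = -R f := fun f => by rw [← zero_sub, hRsub, hR0, zero_sub]
  -- JOIN-A
  obtain ⟨s, s', hs, hfix, hs', hn', hsa', hoff', hN, hτ'⟩ := gaugeParam_kLevel_traceFree (Ω := Ω) (Eb := Eb) (U₀ := U₀) (A := A)
    (DA := fun y => covDivB η U₀ A y) τ hτ hlog hL1 hη hU₀ hEbΩ (⇑g) R Hc hα₄.le hBG hBR hh₀ hh₂ hl₀ hl₁ hl₂ hcA hcA' hcDA ha₁' hb₁' hb₁ hθ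
    hh₀' hh₁' hG (fun f f' => map_sub g f f') hGsupp hGreal hRsub hRbd hRreal hc0 hc1 hc2 hcL0 hcL1 hcL2 hcsa hcsupp hDA hDAsa hA hAsa h103 h106
    hDAτ hcτ hRτ hGτ
  set lam' := lamOf s' with hlam'def
  have hgp : lamOf s + Hc (lamOf s) = lam' := hs'.symm
  -- the Neumann solution at λ′
  set Z : Site d → 𝔸 := Zsol (Wsrc η U₀ A (fun y => covDivB η U₀ A y) lam' (covLap η U₀ (Hc (lamOf s)))) (Vop lam') R with hZdef
  -- the fixed point read through the projection laws: Q′λ = 0 and Δλ = R(−Z)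
  have hfix' : lamOf s = g (R (fun x => -Z x)) := by
    have h := hfix
    simp only [PsiP5] at h
    rw [hgp] at h
    exact h
  have hfix'' : lamOf s = g (R (-Z)) := hfix'
  have hqR : q (g (R (-Z))) = 0 := q_g_proj325_range (R := R) hR c_range (-Z)
  have hq : q (lamOf s) = 0 := by rw [hfix'']; exact hqR
  -- «ΔG′R = R» read POINTWISE on Ω₀ (the right-inverse law of G′ on print's domain)
  have hΔs : ∀ y ∈ Ω 0, Δ (lamOf s) y = R (-Z) y := fun y hy => by
    have h1 := g_rightΩ (R (-Z)) y hy
    rw [hqR, map_zero, map_zero, add_zero] at h1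
    rw [hfix'']
    exact h1
  -- sizes at λ′ on Ω₀
  have hl : ∀ y ∈ Ω 0, ‖lam' y‖ ≤ 1 / 12 := fun y _ => by
    rw [← hgp]; exact (gpar_size hc0 s hs y).trans (ha₁'.trans (by norm_num))
  -- support of λ_s (Dirichlet range of G′)
  have hoff : ∀ x, x ∉ Ω 0 → lamOf s x = 0 := fun x hx => by rw [hfix'']; exact hGsupp _ x hx
  have hind : (Ω 0).indicator (lamOf s) = lamOf s := by
    funext x
    by_cases hx : x ∈ Ω 0
    · rw [Set.indicator_of_mem hx]
    · rw [Set.indicator_of_notMem hx, hoff x hx]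
  refine ⟨lam', hsa', hoff', hτ', fun j hj p hp => ?_, ?_, ?_⟩
  · -- (1.108)
    have h := (norm_le_iff hη.le s' hα₄.le).1 hn'
    exact ⟨h.1 p.1, h.2 j hj p hp⟩
  · -- the multiplier clause, via n04-b's WHY-Z bridge
    have hdef : lam' = lamOf s - (-Hc (lamOf s)) := by rw [sub_neg_eq_add, hgp]
    have hNy : ∀ y ∈ Ω 0, Z y + (gAd (R Z y) (lam' y) - R Z y) =
        conjR (gaugeExp lam' y)⁻¹ (covDivB η U₀ A y) - gAd (covLap η U₀ (-Hc (lamOf s)) y) (lam' y) + ∑ μ, frakF3 η U₀ lam' A y μ := by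
      intro y hy
      have h := hN 0 (Nat.zero_le _) y hy
      simp only [Vop, Wsrc] at h
      rw [h, covLap_neg', gAd_neg _ (hl y hy), sub_neg_eq_add]
    have hΔy : ∀ y ∈ Ω 0, covLap η U₀ (lamOf s) y = -R Z y := by
      intro y hy
      rw [← hind, ← hΔ _ y hy, hΔs y hy, hRneg, Pi.neg_apply]
    refine (multiplier_iff_of_whyZ L k (Ω 0) Λs U₀ A hdef hl hNy hΔy).2 ?_
    set φ := c (q (g Z)) with hφ
    refine ⟨φ - Aw (q (g (qs φ))), fun x hx => ?_⟩
    have hZR : Z - R Z = g (qs φ) := by rw [hR]; abel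
    -- «ΔG′Q′ᵀφ = Q′ᵀ(φ − 𝔄Q′G′Q′ᵀφ)» read POINTWISE on Ω₀
    have hlap : Δ (g (qs φ)) x = qs (φ - Aw (q (g (qs φ)))) x := by
      rw [map_sub, Pi.sub_apply]
      exact eq_sub_of_add_eq (by rw [← Pi.add_apply]; exact g_rightΩ (qs φ) x hx)
    rw [← hΔ _ x hx, hZR, hlap, hqs _ x hx]
  · -- (1.29) for u₁·e^{iλ′} by the LOCAL inversion route
    rw [← hgp]
    exact restr129_mul_gaugeExp_local hLs hs1 hη hd hU₀ hEbT hα hα3 hα4 hcB hα₄ hαP hαP3 hαP2 hBu h33 h69 hP hAx h129 hsmall hc₃ hsc hα₃' hw₁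
      hw₂ hw₃ hw₄ hw₅ hw₆ hprod Hc hh₀' hh₁' hc0 hc1 s hs (h179E s hs hq)

#print axioms hFP_kLevel_of179_local_RD_traceFree

end Literature.MathematicalPhysics.QuantumFieldTheory.Balaban1983to89.B8Prop5JoinSectELocalRDTraceFreeRec

end
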